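import Mathlib
import Literature.Combinatorics.Optimization.CorPolytopeApproximateEFLowerBound
import Literature.Barriers.PneNP.TSPExtensionComplexityHyperplaneBound
import Literature.Computability.Complexity.UniqueDisjointnessCorruption
import HarnessLib

/-!
# Braun–Fiorini–Pokutta–Steurer 2012, Theorem 5: nonnegative rank of UDISJ shifts — the PRIMITIVE named fact behind
# `BFPS2012_corSandwichHard` (Theorem 6), which is DERIVED here; BOTH DISCHARGED (second half of the file)

G. Braun, S. Fiorini, S. Pokutta, D. Steurer, *Approximation Limits of Linear Programs (Beyond Hierarchies)*, FOCS 2012,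
arXiv:1204.0957 [BraunEtAl2012] (journal: Math. Oper. Res. 40 (2015) [BraunEtAl2015]); §3.2 pp. 11–12 (Theorem 5) and §4.1 p. 13
(Theorem 6 ⇐ Theorem 1 + Theorem 5).  Companion of `CorPolytopeApproximateEFLowerBound.lean` (the hard pair `(COR(n), Q(n))`,
`corCliqueMat`, `corOuter`, slack `= udisj`, and the named fact `BFPS2012_corSandwichHard` = Theorem 6, second clause).

CONTENT.
* `BFPS2012_udisjShiftRankHard` — **Theorem 5, second clause, MATRIX LEVEL** («a nonnegative `ρ`-extension `M` of UDISJ — `M_ab = ρ` at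
  `|a ∩ b| = 0`, `M_ab = ρ − 1` at `|a ∩ b| = 1` — with `ρ = O(n^β)`, `β < 1/2`, has `rank₊(M) = 2^{Ω(n^{1−2β})}`»), typed with the constants
  existential, `β ∈ [0, 1/2)`, uniformly in `1 ≤ ρ ≤ C·n^β` (the printed estimate p. 12 is monotone in `ρ`), and «`rank₊ ≥ B`» spelled as
  «every nonnegative factorisation through a finite slot type `S` has `B ≤ |S|`».  NAMED FACT, DISCHARGED below
  (`BFPS2012_udisjShiftRankHard_holds`, from the tree's port of the `ε`-parametrised Razborov rectangle-corruption lemma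
  `Literature.Computability.Complexity.UdisjFrames.corruption_rankOne`, file `UniqueDisjointnessCorruption.lean`, + the half-page
  estimate p. 12 = `udisjShift_nonnegRank_explicit`).
* `BFPS2012_corSandwichHard_of_udisjShiftRankHard` — ★ **Theorem 6 (second clause) FROM Theorem 5**: the tree's Yannakakis factorisation for
  sandwiched sets (`Literature.Barriers.PneNP.HasEFOfSize.exists_nonneg_factorization`, = BFPS Thm 1 lower half) applied to the vertices
  `b bᵀ ∈ COR(n) ⊆ K` and the clique inequalities `⟨2·diag(a) − a aᵀ, x⟩ ≤ ρ` valid on `K ⊆ ρ·Q(n)` factorises the slack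
  `ρ − ⟨2·diag(a) − a aᵀ, b bᵀ⟩ = ρ − 1 + udisj n a b` (`one_sub_flat_corCliqueMat_dotProduct_vecOuter`) — a nonnegative `ρ`-extension of UDISJ —
  through `r + 1` slots; Theorem 5 gives `2^{c·n^{1−2β}} ≤ r + 1`, and halving the constant absorbs the `+1` (`rpow_half_le_of_le_succ`,
  `two_le_mul_rpow_eventually`).  So the tree's two BFPS facts have ONE primitive, and `BFPS2012_corSandwichHard_holds` is this derivation
  applied to `BFPS2012_udisjShiftRankHard_holds`.

PROVENANCE.  Texts (a)/(b) and the two helpers are val-idea-43 g4's §7 «PORT KIT» of the crux workfile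
`Summits/ValiantsHypothesis/…/Cruxes/NNDivisionHard/UdisjEnvelope43.lean` rev 6 (sha16 f11c10c48720ba2d; farm rc 0 there), lifted VERBATIM by name into
the Literature namespace by val-port-3 g3 (planners do not propose Literature files); statement re-read against the materialised arXiv text
p0011 L186–p0012 L6.  Consumers: the 21181 line `Cruxes/NNDivisionHard/Lines/virtual_passenger.lean` (binder `hB5` closes `stub_corSandwichHard`
via `corSandwichHard_of_bfps (BFPS2012_corSandwichHard_of_udisjShiftRankHard hB5)`) and val-idea-43's `UdisjShiftRankHard` stub.

STATEMENT AUDIT OF RECORD (desk val-lit g14 RULINGS #354 (A) / #361 (A)): literature VET = val-lit-lit g18 2026-08-28T22:16:29Z (symbol-by-symbol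
against the materialised pages; PASS); statement audit = val-idea-crit-9 g1 VERDICT #32 (read of the SAME Theorem 5 text as typed by val-idea-43 g4's
`UdisjShiftRankHard` at `β = 1/4`: «= BFPS12 Thm 5 …, uniformity in ρ by monotonicity — faithful, KNOWN (print)») [+ val-idea-crit-9 g2's word if posted
before the press]; the critic of record keeps a post-landing veto (a misstatement finding = an errata fact file + docstring note).

What is NOT here: the first clause (`ρ` fixed ⇒ `2^{Ω(n)}`) as a separate statement — it is the case `β = 0` (derive as for Thm 6 if
needed); nothing here is a summit statement; VP ≠ VNP is NOT proved.
-/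

noncomputable section

open Matrix Finset

namespace Literature.Combinatorics.Optimization

open FixedSizePsdRank (Cube bvec vecOuter flat corPolytope ip udisj)
open Literature.Barriers.PneNP (HasEFOfSize)

/-- **Braun–Fiorini–Pokutta–Steurer 2012, Theorem 5 (second clause) — nonnegative rank of UDISJ shifts, MATRIX LEVEL; the PRIMITIVE
named fact.**  «Let `M ∈ ℝ₊^{2ⁿ×2ⁿ}` (rows and columns indexed by `{0,1}ⁿ`) be a `ρ`-extension of UDISJ: `M_ab = ρ` whenever `|a ∩ b| = 0` and
`M_ab = ρ − 1` whenever `|a ∩ b| = 1` (other entries arbitrary nonnegative).  If `ρ = O(n^β)` for some constant `β < 1/2` then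
`rank₊(M) = 2^{Ω(n^{1−2β})}`.»  Constants existential as printed: for every `β ∈ [0, 1/2)` and `C > 0` there are `c > 0` and `n₀` such that for
`n ≥ n₀`, `1 ≤ ρ ≤ C·n^β`, every nonnegative factorisation of such an `M` through a finite slot type `S` has `2^{c·n^{1−2β}} ≤ |S|`.  NOT proved
(print: Razborov's rectangle-corruption lemma = their Lemma 5, pp. 8–11, + the half-page estimate p. 12; port size L).
VERBATIM PRINT TEXT (materialised arXiv:1204.0957, `lit read` pages): p0011.txt L186–189 «We say that M is a ρ-extension of UDISJ, if
M_{ab} = ρ whenever |a ∩ b| = 0 and M_{ab} = ρ − 1 whenever |a ∩ b| = 1 with a, b ∈ {0,1}ⁿ.»; p0011.txt L195 «Theorem 5 (Nonnegative rank of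
UDISJ shifts).»; p0012.txt L1–6 «Let M ∈ ℝ₊^{2ⁿ×2ⁿ} be a ρ-extension of UDISJ as above. • If ρ is a fixed constant, then rank₊(M) = 2^{Ω(n)}.
• If ρ = O(n^β) for some constant β < 1/2 then rank₊(M) = 2^{Ω(n^{1−2β})}.»  (Only the second bullet is typed; the first is its case `β = 0`.)  Uniformity of `c, n₀` in `ρ ≤ C·n^β` and in `M` is
what the printed proof gives (p0012.txt L52–60: `ε = 1/(2Cn^β)`; Lemma 5's `O(log ℓ)` constant is absolute, p0009.txt L53); the print's «WLOG
`n ≡ 3 (mod 4)`» (p0012.txt L8) is absorbed by the constants (restrict `a, b` to a sub-cube of dimension `n' ≡ 3 (mod 4)`, `n' ≥ n − 3`: a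
`ρ`-extension restricts to a `ρ`-extension and `rank₊` of a submatrix does not exceed `rank₊`).
[cite: BraunEtAl2012, Thm 5 (§3.2, pp. 11–12)] -/
def BFPS2012_udisjShiftRankHard : Prop :=
  ∀ β : ℝ, 0 ≤ β → β < 1 / 2 → ∀ C : ℝ, 0 < C →
    ∃ c : ℝ, 0 < c ∧ ∃ n₀ : ℕ, ∀ n : ℕ, n₀ ≤ n → ∀ ρ : ℝ, 1 ≤ ρ → ρ ≤ C * (n : ℝ) ^ β →
      ∀ M : Cube n → Cube n → ℝ, (∀ a b, 0 ≤ M a b) →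
        (∀ a b, ip a b = 0 → M a b = ρ) → (∀ a b, ip a b = 1 → M a b = ρ - 1) →
        ∀ (S : Type) [Fintype S] (U : Cube n → S → ℝ) (V : Cube n → S → ℝ),
          (∀ a i, 0 ≤ U a i) → (∀ b i, 0 ≤ V b i) → (∀ a b, M a b = ∑ i, U a i * V b i) →
          (2 : ℝ) ^ (c * (n : ℝ) ^ (1 - 2 * β)) ≤ Fintype.card S

/-- Halving the constant absorbs the affine slot: `2^{c·x} ≤ r + 1` with `c·x ≥ 2` gives `2^{(c/2)·x} ≤ r`. [folklore] -/
private theorem rpow_half_le_of_le_succ {c x : ℝ} {r : ℕ} (hcx : 2 ≤ c * x) (h : (2 : ℝ) ^ (c * x) ≤ r + 1) :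
    (2 : ℝ) ^ (c / 2 * x) ≤ r := by
  have hsplit : (2 : ℝ) ^ (c * x) = (2 : ℝ) ^ (c / 2 * x) * (2 : ℝ) ^ (c / 2 * x) := by
    rw [← Real.rpow_add (by norm_num : (0 : ℝ) < 2)]; ring_nf
  have h2 : (2 : ℝ) ≤ (2 : ℝ) ^ (c / 2 * x) := by
    calc (2 : ℝ) = (2 : ℝ) ^ (1 : ℝ) := (Real.rpow_one 2).symm
      _ ≤ (2 : ℝ) ^ (c / 2 * x) := Real.rpow_le_rpow_of_exponent_le (by norm_num) (by linarith)
  set y := (2 : ℝ) ^ (c / 2 * x) with hy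
  have hyy : y * y ≤ r + 1 := by rw [← hsplit]; exact h
  have h2y : 2 * y ≤ y * y := by nlinarith
  have hr : (3 : ℝ) ≤ r := by nlinarith
  nlinarith

/-- Eventually `2 ≤ c·n^γ` (`c, γ > 0`). [folklore] -/
private theorem two_le_mul_rpow_eventually {c γ : ℝ} (hc : 0 < c) (hγ : 0 < γ) :
    ∃ N : ℕ, ∀ n : ℕ, N ≤ n → 2 ≤ c * (n : ℝ) ^ γ := by
  refine ⟨⌈(2 / c) ^ γ⁻¹⌉₊, fun n hn => ?_⟩
  have hle : (2 / c) ^ γ⁻¹ ≤ (n : ℝ) := le_trans (Nat.le_ceil _) (by exact_mod_cast hn)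
  have hroot : ((2 / c) ^ γ⁻¹) ^ γ ≤ (n : ℝ) ^ γ := Real.rpow_le_rpow (by positivity) hle hγ.le
  rw [Real.rpow_inv_rpow (by positivity) hγ.ne'] at hroot
  have hcc : c * (2 / c) = 2 := by field_simp
  have := mul_le_mul_of_nonneg_left hroot hc.le
  rwa [hcc] at this

/-- ★ **Theorem 6 (second clause) FROM Theorem 5** — the named fact `BFPS2012_corSandwichHard` (`CorPolytopeApproximateEFLowerBound.lean`) is a
theorem over the primitive one:
the clique inequalities `⟨2·diag(a) − aaᵀ, x⟩ ≤ ρ` are valid on `K ⊆ ρ·Q(n)`, the vertices `bbᵀ ∈ COR(n) ⊆ K`, so an EF of `K` with `r`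
inequalities factorises the slack `ρ − ⟨2·diag(a) − aaᵀ, bbᵀ⟩ = ρ − 1 + (1 − aᵀb)²` — a nonnegative `ρ`-extension of UDISJ — through `r + 1`
slots (Thm 1 / Yannakakis, tree `HasEFOfSize.exists_nonneg_factorization`); Thm 5 gives `2^{c n^{1−2β}} ≤ r + 1`, hence `2^{(c/2) n^{1−2β}} ≤ r`.
[cite: BraunEtAl2012, Thm 6 ⇐ Thm 1 + Thm 5 (§4.1, p. 13)] -/
theorem BFPS2012_corSandwichHard_of_udisjShiftRankHard (h5 : BFPS2012_udisjShiftRankHard) :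
    BFPS2012_corSandwichHard := by
  classical
  intro β hβ0 hβ C hC
  obtain ⟨c, hc, n₀, hn₀⟩ := h5 β hβ0 hβ C hC
  have hγ : 0 < 1 - 2 * β := by linarith
  obtain ⟨N, hN⟩ := two_le_mul_rpow_eventually hc hγ
  refine ⟨c / 2, by positivity, max n₀ N, fun n hn ρ hρ1 hρC K r hP hQ hEF => ?_⟩
  have hn₀' : n₀ ≤ n := le_trans (le_max_left _ _) hn
  have hN' : N ≤ n := le_trans (le_max_right _ _) hn
  have hv : ∀ b : Cube n, vecOuter n (bvec b) ∈ K := fun b => hP (subset_convexHull ℝ _ ⟨b, rfl⟩)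
  have hvalid : ∀ a : Cube n, ∀ x ∈ K, flat (corCliqueMat a) ⬝ᵥ x ≤ ρ := fun a x hx => (mem_corOuter.1 (hQ hx)) a
  obtain ⟨U, V, hU0, hV0, hfac⟩ :=
    Literature.Barriers.PneNP.HasEFOfSize.exists_nonneg_factorization hEF (fun b : Cube n => vecOuter n (bvec b)) hv
      (fun a : Cube n => flat (corCliqueMat a)) (fun _ => ρ) hvalid
  have hM : ∀ a b : Cube n, ρ - flat (corCliqueMat a) ⬝ᵥ vecOuter n (bvec b) = ρ - 1 + udisj n a b := by
    intro a b; rw [← one_sub_flat_corCliqueMat_dotProduct_vecOuter]; ring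
  have hud : ∀ a b : Cube n, 0 ≤ udisj n a b := fun a b => sq_nonneg _
  have key := hn₀ n hn₀' ρ hρ1 hρC (fun a b => ρ - flat (corCliqueMat a) ⬝ᵥ vecOuter n (bvec b))
    (fun a b => by rw [hM]; linarith [hud a b])
    (fun a b hab => by rw [hM]; simp [udisj, hab])
    (fun a b hab => by rw [hM]; simp [udisj, hab])
    (Option (Fin r)) U V hU0 hV0 (fun a b => hfac a b)
  rw [Fintype.card_option, Fintype.card_fin] at key
  push_cast at key
  exact rpow_half_le_of_le_succ (hN n hN') key


/-! ## Theorem 5 PROVED (BFPS 2012 §3.2, p. 12) and the discharges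

The printed proof of Theorem 5 (p. 12): write `M = Σ_{i ≤ r} X_i`, `X_i = f_i ⊗ g_i ≥ 0`; then
`E[M | A] = ρ`, `E[M | B] = ρ − 1`, and summing Lemma 4 over `i` gives
`(1 − ε)ρ − (ρ − 1) ≤ r ρ 2^{−ε²ℓ/(16 ln 2) + O(log ℓ)}`; take `ε = 1/(2 C n^β)`.  Here Lemma 4 is the tree
theorem `Literature.Computability.Complexity.UdisjFrames.corruption_rankOne` (file
`UniqueDisjointnessCorruption.lean`: `(1 − ε) sumA(f ⊗ g) − 3 sumB(f ⊗ g) ≤ 24·2ℓ·e^{−ε²ℓ/36}·N·sumB(1)`),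
we take `ε = 1/(2ρ)` directly (the printed `ε = 1/(2Cn^β) ≤ 1/(2ρ)` only serves `1/ρ − ε ≥ 1/(2Cn^β)`), and
obtain the explicit set form `e^{ℓ/(144 ρ²)} ≤ 32 ℓ ρ · r` (`udisjShift_nonnegRank_explicit`), whence the
typed `2^{c n^{1−2β}} ≤ r` for `ρ ≤ C n^β`, `n ≥ n₀` (`BFPS2012_udisjShiftRankHard_holds`) and Theorem 6
(`BFPS2012_corSandwichHard_holds`). [cite: BraunEtAl2012, Thm 5 and its proof (§3.2, p. 12); Thm 6 (§4.1, p. 13)]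
-/

section Discharge

open Literature.Computability.Complexity.UdisjFrames

/-- **Theorem 5, explicit set form.**  Let `α` be a finite type with `4k + 3 ≤ |α|` (`ℓ = k + 1`),
`ρ ≥ 1`, and `M : 2^α × 2^α → ℝ` a `ρ`-extension of UDISJ (`M(a,b) = ρ` if `a ∩ b = ∅`, `= ρ − 1` if
`|a ∩ b| = 1`) with a non-negative factorisation `M(a,b) = Σ_{s ∈ S} U(a,s) V(b,s)`.  Then
`e^{ℓ/(144ρ²)} ≤ 32 ℓ ρ |S|` (the printed `r ≥ (1/ρ − ε) 2^{ε²ℓ/(16 ln 2) − O(log ℓ)}` at `ε = 1/(2ρ)`).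
[cite: BraunEtAl2012, Thm 5, proof (§3.2, p. 12)] -/
theorem udisjShift_nonnegRank_explicit {α : Type*} [DecidableEq α] [Fintype α] {k : ℕ}
    (hk : 4 * k + 3 ≤ Fintype.card α) {ρ : ℝ} (hρ : 1 ≤ ρ) (M : Finset α → Finset α → ℝ)
    (hMA : ∀ a b, Disjoint a b → M a b = ρ) (hMB : ∀ a b, (a ∩ b).card = 1 → M a b = ρ - 1)
    {S : Type*} [Fintype S] (U V : Finset α → S → ℝ) (hU : ∀ a s, 0 ≤ U a s) (hV : ∀ b s, 0 ≤ V b s)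
    (hM : ∀ a b, M a b = ∑ s, U a s * V b s) :
    Real.exp ((k + 1 : ℝ) / (144 * ρ ^ 2)) ≤ 32 * (k + 1) * ρ * Fintype.card S := by
  have hne := frames_nonempty (α := α) (k := k) hk
  have hZ := sumB_one_pos hne
  set Z := sumB (α := α) k (fun _ _ => 1) with hZdef
  have hρ0 : 0 < ρ := by linarith
  set ε : ℝ := 1 / (2 * ρ) with hε
  have hε0 : 0 < ε := by positivity
  -- the max-norm hypothesis for each rank-one term
  have hN : ∀ s a b, (a ∩ b).card ≤ 1 → U a s * V b s ≤ ρ := by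
    intro s a b hab
    have h1 : U a s * V b s ≤ M a b := by
      rw [hM]
      exact Finset.single_le_sum (f := fun s => U a s * V b s) (fun t _ => mul_nonneg (hU a t) (hV b t))
        (Finset.mem_univ s)
    have h2 : M a b ≤ ρ := by
      rcases Nat.le_one_iff_eq_zero_or_eq_one.1 hab with h0 | h1'
      · rw [hMA a b (Finset.disjoint_iff_inter_eq_empty.2 (Finset.card_eq_zero.1 h0))]
      · rw [hMB a b h1']; linarith
    exact h1.trans h2
  -- Lemma 4 for each slot, summed
  have hsum : ∑ s, ((1 - ε) * sumA k (fun a b => U a s * V b s) - 3 * sumB k (fun a b => U a s * V b s)) ≤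
      ∑ s : S, 24 * (2 * k + 2) * Real.exp (-(ε ^ 2 * (k + 1) / 36)) * ρ * Z :=
    Finset.sum_le_sum fun s _ => corruption_rankOne k hε0 (fun a => U a s) (fun b => V b s) (fun a => hU a s)
      (fun b => hV b s) (hN s)
  rw [Finset.sum_const, nsmul_eq_mul, Finset.card_univ, Finset.sum_sub_distrib, ← Finset.mul_sum, ← Finset.mul_sum,
    ← sumA_finset_sum, ← sumB_finset_sum] at hsum
  have hMfun : (fun a b => ∑ s, U a s * V b s) = M := by
    funext a b; rw [hM]
  rw [hMfun, sumA_eq_of_disjoint hMA, sumB_eq_of_card_inter hMB, sumA_one] at hsum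
  -- `hsum : (1 - ε) * (ρ * (3 * Z)) - 3 * ((ρ - 1) * Z) ≤ |S| * (24 (2k+2) e^{..} ρ Z)`
  have hερ : ε * ρ = 1 / 2 := by rw [hε]; field_simp
  have hexp : ε ^ 2 * (k + 1) / 36 = (k + 1 : ℝ) / (144 * ρ ^ 2) := by
    rw [hε]; field_simp; ring
  rw [hexp] at hsum
  have hkey : (3 * Z) * (1 / 2) ≤ (3 * Z) * (16 * (k + 1) * ρ * Fintype.card S *
      Real.exp (-((k + 1 : ℝ) / (144 * ρ ^ 2)))) := by
    have : (1 - ε) * (ρ * (3 * Z)) - 3 * ((ρ - 1) * Z) = (3 * Z) * (1 - ε * ρ) := by ring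
    rw [this, hερ] at hsum
    have : (Fintype.card S : ℝ) * (24 * (2 * k + 2) * Real.exp (-((k + 1 : ℝ) / (144 * ρ ^ 2))) * ρ * Z) =
        (3 * Z) * (16 * (k + 1) * ρ * Fintype.card S * Real.exp (-((k + 1 : ℝ) / (144 * ρ ^ 2)))) := by ring
    rw [this] at hsum
    convert hsum using 2
    norm_num
  have hkey' := le_of_mul_le_mul_left hkey (by positivity)
  rw [Real.exp_neg] at hkey'
  have hE := Real.exp_pos ((k + 1 : ℝ) / (144 * ρ ^ 2))
  have := mul_le_mul_of_nonneg_right hkey' hE.le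
  rw [mul_assoc, inv_mul_cancel₀ hE.ne', mul_one] at this
  linarith

/-- `aᵀb = |a ∩ b|` for indicator strings of subsets of `[n]`. [cite: BraunEtAl2012, §3.2 ("we index the rows
and columns with elements in `{0,1}ⁿ`", p. 11)] -/
theorem ip_indicator {n : ℕ} (x y : Finset (Fin n)) :
    ip (fun i => decide (i ∈ x)) (fun i => decide (i ∈ y)) = (x ∩ y).card := by
  unfold ip
  congr 1
  ext i
  simp

/-- **Quasi-polynomial beats polynomial**: `K · n^p ≤ e^{a n^γ}` for `n ≥ n₀` (`a, γ > 0`), via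
`log n ≤ n^{γ/2}/(γ/2)`. [cite: BraunEtAl2012, Thm 5 proof ("This leads to the lower bound
`r ≥ 2^{Ω(n^{1−2β})}`", p. 12)] -/
theorem eventually_mul_rpow_le_exp (K p : ℝ) {a γ : ℝ} (ha : 0 < a) (hγ : 0 < γ) :
    ∃ n₀ : ℕ, ∀ n : ℕ, n₀ ≤ n → K * (n : ℝ) ^ p ≤ Real.exp (a * (n : ℝ) ^ γ) := by
  set L := max 0 (Real.log K) with hL
  set p' := max 0 p with hp'
  set Q := max 1 ((L + 2 * p' / γ) / a) with hQ
  refine ⟨⌈Q ^ (2 / γ)⌉₊ + 1, fun n hn => ?_⟩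
  have hn1 : (1 : ℝ) ≤ n := by exact_mod_cast (by omega : 1 ≤ n)
  have hn0 : (0 : ℝ) < n := by linarith
  rcases le_or_gt K 0 with hK | hK
  · exact ((mul_nonpos_of_nonpos_of_nonneg hK (by positivity))).trans (Real.exp_pos _).le
  -- `n^{γ/2} ≥ Q`
  have hQ1 : 1 ≤ Q := le_max_left _ _
  have hQ0 : 0 < Q := by linarith
  have hnγ : Q ≤ (n : ℝ) ^ (γ / 2) := by
    have h1 : Q ^ (2 / γ) ≤ n := le_trans (Nat.le_ceil _) (by exact_mod_cast (by omega : ⌈Q ^ (2 / γ)⌉₊ ≤ n))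
    have h2 := Real.rpow_le_rpow (by positivity) h1 (by positivity : 0 ≤ γ / 2)
    rwa [← Real.rpow_mul hQ0.le, show 2 / γ * (γ / 2) = 1 by field_simp, Real.rpow_one] at h2
  have hnγ1 : 1 ≤ (n : ℝ) ^ (γ / 2) := hQ1.trans hnγ
  -- `K n^p = exp(log K + p log n) ≤ exp(L + p' (2/γ) n^{γ/2})`
  have hlogn : 0 ≤ Real.log n := Real.log_nonneg hn1
  have hlog : Real.log n ≤ (n : ℝ) ^ (γ / 2) / (γ / 2) := Real.log_le_rpow_div hn0.le (by positivity)
  have h1 : K * (n : ℝ) ^ p = Real.exp (Real.log K + p * Real.log n) := by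
    rw [Real.exp_add, Real.exp_log hK, Real.rpow_def_of_pos hn0, mul_comm (Real.log n)]
  rw [h1, Real.exp_le_exp]
  have h2 : Real.log K ≤ L := le_max_right _ _
  have h3 : p * Real.log n ≤ p' * ((n : ℝ) ^ (γ / 2) / (γ / 2)) := by
    calc p * Real.log n ≤ p' * Real.log n := mul_le_mul_of_nonneg_right (le_max_right _ _) hlogn
      _ ≤ p' * ((n : ℝ) ^ (γ / 2) / (γ / 2)) := mul_le_mul_of_nonneg_left hlog (le_max_left _ _)
  have h4 : L + p' * ((n : ℝ) ^ (γ / 2) / (γ / 2)) ≤ (L + 2 * p' / γ) * (n : ℝ) ^ (γ / 2) := by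
    have hL0 : 0 ≤ L := le_max_left _ _
    have : p' * ((n : ℝ) ^ (γ / 2) / (γ / 2)) = 2 * p' / γ * (n : ℝ) ^ (γ / 2) := by
      field_simp
    rw [this, add_mul]
    nlinarith
  have h5 : (L + 2 * p' / γ) * (n : ℝ) ^ (γ / 2) ≤ a * Q * (n : ℝ) ^ (γ / 2) := by
    apply mul_le_mul_of_nonneg_right _ (by positivity)
    have : (L + 2 * p' / γ) / a ≤ Q := le_max_right _ _
    rw [div_le_iff₀ ha] at this
    linarith
  have h6 : a * Q * (n : ℝ) ^ (γ / 2) ≤ a * (n : ℝ) ^ γ := by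
    have : (n : ℝ) ^ γ = (n : ℝ) ^ (γ / 2) * (n : ℝ) ^ (γ / 2) := by
      rw [← Real.rpow_add hn0]; ring_nf
    rw [this, ← mul_assoc]
    exact mul_le_mul_of_nonneg_right (mul_le_mul_of_nonneg_left hnγ ha.le) (by positivity)
  linarith

/-- ★ **Braun–Fiorini–Pokutta–Steurer 2012, Theorem 5 (second clause) — DISCHARGED.**  From
`udisjShift_nonnegRank_explicit` on `Fin n` with `ℓ = ⌊(n+1)/4⌋ ≥ n/4 − 1/2` (so `e^{ℓ/(144ρ²)} ≥
e^{n/(1152 C² n^{2β})}` for `n ≥ 4`, `ρ ≤ C n^β`) and `32 ℓ ρ ≤ 16 C n^{1+β}`; the polynomial factor is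
absorbed by `eventually_mul_rpow_le_exp`, giving `2^{c n^{1−2β}} ≤ |S|` with `c = 1/(2304 C² log 2)`.
[cite: BraunEtAl2012, Thm 5 (§3.2, pp. 11–12)] -/
theorem BFPS2012_udisjShiftRankHard_holds : BFPS2012_udisjShiftRankHard := by
  intro β hβ0 hβ C hC
  set γ : ℝ := 1 - 2 * β with hγ
  have hγ0 : 0 < γ := by rw [hγ]; linarith
  set a : ℝ := 1 / (1152 * C ^ 2) with ha
  have ha0 : 0 < a := by positivity
  obtain ⟨n₁, hn₁⟩ := eventually_mul_rpow_le_exp (16 * C) (1 + β) (half_pos ha0) hγ0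
  refine ⟨a / 2 / Real.log 2, by positivity, max n₁ 4, fun n hn ρ hρ1 hρC M hM0 hMA hMB S _ U V hU hV hfac => ?_⟩
  have hn4 : 4 ≤ n := le_trans (le_max_right _ _) hn
  have hnn₁ : n₁ ≤ n := le_trans (le_max_left _ _) hn
  have hn0 : (0 : ℝ) < n := by exact_mod_cast (by omega : 0 < n)
  have hρ0 : 0 < ρ := by linarith
  -- transport to subsets of `Fin n`
  set k := (n + 1) / 4 - 1 with hk
  have hk4 : 4 * k + 3 ≤ Fintype.card (Fin n) := by rw [Fintype.card_fin]; omega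
  have key := udisjShift_nonnegRank_explicit (α := Fin n) hk4 hρ1
    (fun x y => M (fun i => decide (i ∈ x)) (fun i => decide (i ∈ y)))
    (fun x y hxy => hMA _ _ (by rw [ip_indicator, Finset.disjoint_iff_inter_eq_empty.1 hxy, Finset.card_empty]))
    (fun x y hxy => hMB _ _ (by rw [ip_indicator, hxy]))
    (fun x s => U (fun i => decide (i ∈ x)) s) (fun y s => V (fun i => decide (i ∈ y)) s) (fun x s => hU _ s)
    (fun y s => hV _ s) (fun x y => hfac _ _)
  -- `ℓ = k + 1 ≥ n/4 - 1/2 ≥ n/8` and `ℓ ≤ n`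
  have hℓlow : (n : ℝ) / 8 ≤ (k + 1 : ℝ) := by
    have h1 : n ≤ 4 * (k + 1) + 2 := by omega
    have h2 : (n : ℝ) ≤ 4 * (k + 1 : ℝ) + 2 := by exact_mod_cast h1
    have h3 : (4 : ℝ) ≤ n := by exact_mod_cast hn4
    linarith
  have hℓup : (k + 1 : ℝ) ≤ n / 2 := by
    have h1 : 2 * (k + 1) ≤ n := by omega
    have h2 : (2 : ℝ) * (k + 1 : ℝ) ≤ n := by exact_mod_cast h1
    linarith
  -- exponent: `a n^γ ≤ (k+1)/(144 ρ²)`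
  have hρ2 : ρ ^ 2 ≤ C ^ 2 * (n : ℝ) ^ (2 * β) := by
    have h1 : ρ ^ 2 ≤ (C * (n : ℝ) ^ β) ^ 2 := pow_le_pow_left₀ hρ0.le hρC 2
    rw [mul_pow, ← Real.rpow_natCast ((n : ℝ) ^ β) 2, ← Real.rpow_mul hn0.le] at h1
    convert h1 using 3
    push_cast; ring
  have hnγ : (n : ℝ) ^ γ = n / (n : ℝ) ^ (2 * β) := by
    rw [hγ, Real.rpow_sub hn0, Real.rpow_one]
  have hexp_le : a * (n : ℝ) ^ γ ≤ (k + 1 : ℝ) / (144 * ρ ^ 2) := by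
    rw [hnγ, ha, le_div_iff₀ (by positivity)]
    have hpow0 : (0 : ℝ) < (n : ℝ) ^ (2 * β) := Real.rpow_pos_of_pos hn0 _
    calc 1 / (1152 * C ^ 2) * (n / (n : ℝ) ^ (2 * β)) * (144 * ρ ^ 2)
        = (n : ℝ) / 8 * (ρ ^ 2 / (C ^ 2 * (n : ℝ) ^ (2 * β))) := by field_simp; ring
      _ ≤ (n : ℝ) / 8 * 1 := by
          apply mul_le_mul_of_nonneg_left _ (by positivity)
          rw [div_le_one (by positivity)]; exact hρ2
      _ ≤ (k + 1 : ℝ) := by linarith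
  -- polynomial factor: `32 (k+1) ρ ≤ 16 C n^{1+β}`
  have hpoly : 32 * (k + 1 : ℝ) * ρ ≤ 16 * C * (n : ℝ) ^ (1 + β) := by
    rw [Real.rpow_add hn0, Real.rpow_one]
    calc 32 * (k + 1 : ℝ) * ρ ≤ 32 * ((n : ℝ) / 2) * (C * (n : ℝ) ^ β) :=
          mul_le_mul (mul_le_mul_of_nonneg_left hℓup (by norm_num)) hρC hρ0.le (by positivity)
      _ = 16 * C * (n * (n : ℝ) ^ β) := by ring
  -- combine
  have hS : Real.exp (a * (n : ℝ) ^ γ) ≤ Real.exp (a / 2 * (n : ℝ) ^ γ) * Fintype.card S :=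
    calc Real.exp (a * (n : ℝ) ^ γ) ≤ Real.exp ((k + 1 : ℝ) / (144 * ρ ^ 2)) := Real.exp_le_exp.2 hexp_le
      _ ≤ 32 * (k + 1) * ρ * Fintype.card S := key
      _ ≤ 16 * C * (n : ℝ) ^ (1 + β) * Fintype.card S := mul_le_mul_of_nonneg_right hpoly (Nat.cast_nonneg _)
      _ ≤ Real.exp (a / 2 * (n : ℝ) ^ γ) * Fintype.card S :=
          mul_le_mul_of_nonneg_right (hn₁ n hnn₁) (Nat.cast_nonneg _)
  have hsplit : Real.exp (a * (n : ℝ) ^ γ) = Real.exp (a / 2 * (n : ℝ) ^ γ) * Real.exp (a / 2 * (n : ℝ) ^ γ) := by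
    rw [← Real.exp_add]; ring_nf
  rw [hsplit] at hS
  have hS' := le_of_mul_le_mul_left hS (Real.exp_pos _)
  have h2 : (2 : ℝ) ^ (a / 2 / Real.log 2 * (n : ℝ) ^ (1 - 2 * β)) = Real.exp (a / 2 * (n : ℝ) ^ γ) := by
    rw [Real.rpow_def_of_pos (by norm_num : (0 : ℝ) < 2), hγ]
    congr 1
    have := Real.log_pos (one_lt_two : (1 : ℝ) < 2)
    field_simp
  rw [h2]
  exact hS'

/-- ★ **Braun–Fiorini–Pokutta–Steurer 2012, Theorem 6 (second clause) — DISCHARGED** (from Theorem 5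
via the tree theorem `BFPS2012_corSandwichHard_of_udisjShiftRankHard`; the fact is declared upstream in
`CorPolytopeApproximateEFLowerBound.lean`, which this file imports, so its `_holds` lives here).
[cite: BraunEtAl2012, Thm 6 (§4.1, p. 13)] -/
theorem BFPS2012_corSandwichHard_holds : BFPS2012_corSandwichHard :=
  BFPS2012_corSandwichHard_of_udisjShiftRankHard BFPS2012_udisjShiftRankHard_holds

end Discharge

end Literature.Combinatorics.Optimization
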